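import Summits.MatrixMultiplication.MatrixMultiplication.Theorems.SaturationLadderLevelTwoK3Word
import Literature.Computability.AlgebraicComplexity.RectangularExponentAlpha
import HarnessLib

/-!
# Level 2 of the saturation ladder at `ω(1,3,1)`: `ω(1,3,1) ≤ 80/19 = 4.21053…`
# (route `SaturationLadder`, node `TailDescentTwo`, lens 1, gen 22)

Cell `decomp-mm`, lens 1 («grading / quantitative ladder»), gen 22, file 5 of 5.  No named
facts, no sorry, no definitions (design and law in `SaturationLadderLevelTwoK3Word`, shared lemmas in
`SaturationLadderLevelTwoKit`).  Companion of `SaturationLadderLevelTwoK2` (`ω(1,2,1) ≤ 101/31`),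
same kernel, same proof shape.

THE RUNG.  The hypothesis of the node `TailDescentTwo` is `∃ k ≥ 3, ω(1,k,1) = k + 1`; its first
instance is `ω(1,3,1) = 4`.  The tree's unconditional price so far was the level-1 five-pattern
bound `ω(1,3,1) ≤ 13/3 = 4.3333` (`OctaveBudgetKernelFamily.farEdge_three`); the printed value
`4.198809` (Williams–Xu–Xu–Zhou 2024, Table 1) enters other routes only as a HYPOTHESIS.  This file
proves at LEVEL 2 (Le Gall 2012 §6.1, the square `CW_q^{⊗2}` with the family `{[112],[121],[211]}`
extracted jointly in the proportion `3 : 3 : 2`, `σ = 19/20`, `b̃ = 1`)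

  **`ω(1,3,1) ≤ 80/19 = 4.210526…`**  (`omegaRect_one_three_one_le_80_19`),

`0.123` below `13/3`, `0.048` below descent from the `k = 2` rung (`101/31 + 1`), `0.0029` above
the real optimum `4.20766` of this kernel and `0.0117` above the printed level-∞ value.  Read on the
node: the level-2 defect `ω(1,k,1) − (k+1)` decreases from `0.2581` (`k = 2`) to `0.2106`
(`k = 3`), and descends to the whole tail as `ω(1,k,1) ≤ k + 23/19` (`k ≥ 3`,
`omegaRect_one_mid_one_le_add_of_three`).

THE PROOF.  As for `k = 2`: the law of the word is of product form `f(I) g(J) g(L)` on the fourteen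
used letters (`f = (67712/11, 12696/11, 276, 2)`, `g = (1, 1, 33/92, 99/4232, 11/16928)`;
`2·n₁₃₀·n₀₂₂ = 3·n₂₂₀·n₀₃₁`), the unused row `I = 4` does not change the penalty
(`maxEntropyPenalty_eq_of_row_zero`), so the penalty is `0`; marginals `x : (1088, 882, 474, 4, 0)/2448`,
`y = z : (132, 836, 1305, 171, 4)/2448`, `H_y ≤ H_x` (`cert_marginals`); formats `A³ ≤ B` by
`6^12834 ≤ 12^2010 · 38^4950`; packing `2^{H_y} W A^{ω(1,3,1)} ≤ R̃(CW_6^{⊗2}) ≤ 64` and the final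
integer certificate `2^46468 · 5^24795 · 11^18392 · 19^11213 · 29^24795 ≤ 3^91948 · 17^46512`.

Bookkeeping (exact design, instrument `certs_k3.py`): `H_x = 1.056600`, `H_y = H_z = 1.056111`
nats, `ln B/ln A = 3.000316`, bound `4.2083731`, slack to `80/19`: `2.2e-3`.

## References

* F. Le Gall, *Faster algorithms for rectangular matrix multiplication*, FOCS 2012,
  arXiv:1204.1111, §3, §6.1, Prop. 6.2, Table 2. [LeGall2012]
* D. Coppersmith, S. Winograd, *Matrix multiplication via arithmetic progressions*,
  J. Symbolic Comput. 9 (1990), §8. [CoppersmithWinograd1990]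
* D. Coppersmith, *Rectangular matrix multiplication revisited*, J. Complexity 13 (1997), §3.
  [Coppersmith1997]
* F. Le Gall, *Powers of tensors and fast matrix multiplication*, ISSAC 2014, arXiv:1401.7714,
  Thm. 4.1 and Appendix A.3. [LeGall2014]
* V. Vassilevska Williams, Y. Xu, Z. Xu, R. Zhou, *New bounds for matrix multiplication: from
  alpha to omega*, SODA 2024, Table 1. [VassilevskaWilliamsXuXuZhou2024]
-/

set_option linter.dupNamespace false
set_option autoImplicit false
set_option exponentiation.threshold 100000
set_option maxRecDepth 100000

noncomputable section

open Finset Real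
open scoped BigOperators

namespace Summit.MatrixMultiplication.MatrixMultiplication.Theorems.SaturationLadderLevelTwoK3

open Literature.Computability.AlgebraicComplexity
open SaturationLadderLevelTwoKit
open SaturationLadderLevelTwo (append_mem repWord_mem const_mem fin5_lits negMulLog_div'
  log_two_mul_shannonEntropy_fin5)

/-! ## Marginal entropies -/

/-- **`ln 2 · H_x = ln 2448 − (1088 ln 1088 + 882 ln 882 + 474 ln 474 + 4 ln 4)/2448`.** [folklore] -/
theorem entropy₁_lvl2Law : Real.log 2 * shannonEntropy (marginalDist₁ lvl2Law) =
    Real.log 2448 - (1088 * Real.log 1088 + 882 * Real.log 882 + 474 * Real.log 474 +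
      4 * Real.log 4) / 2448 := by
  obtain ⟨e0, e1, e2, e3, e4⟩ := marginalDist₁_lvl2Law
  rw [log_two_mul_shannonEntropy_fin5, e0, e1, e2, e3, e4,
    negMulLog_div' (by norm_num) (by norm_num), negMulLog_div' (by norm_num) (by norm_num),
    negMulLog_div' (by norm_num) (by norm_num), negMulLog_div' (by norm_num) (by norm_num),
    Real.negMulLog_zero]
  ring

/-- **`ln 2 · H_y = ln 2448 − (132 ln 132 + 836 ln 836 + 1305 ln 1305 + 171 ln 171 + 4 ln 4)/2448`.**
[folklore] -/
theorem entropy₂_lvl2Law : Real.log 2 * shannonEntropy (marginalDist₂ lvl2Law) =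
    Real.log 2448 - (132 * Real.log 132 + 836 * Real.log 836 + 1305 * Real.log 1305 +
      171 * Real.log 171 + 4 * Real.log 4) / 2448 := by
  obtain ⟨e0, e1, e2, e3, e4⟩ := marginalDist₂_lvl2Law
  rw [log_two_mul_shannonEntropy_fin5, e0, e1, e2, e3, e4,
    negMulLog_div' (by norm_num) (by norm_num), negMulLog_div' (by norm_num) (by norm_num),
    negMulLog_div' (by norm_num) (by norm_num), negMulLog_div' (by norm_num) (by norm_num),
    negMulLog_div' (by norm_num) (by norm_num)]
  ring

/-- `ln 2 · H_z = ln 2 · H_y`. [folklore] -/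
theorem entropy₃_lvl2Law : Real.log 2 * shannonEntropy (marginalDist₃ lvl2Law) =
    Real.log 2448 - (132 * Real.log 132 + 836 * Real.log 836 + 1305 * Real.log 1305 +
      171 * Real.log 171 + 4 * Real.log 4) / 2448 := by
  obtain ⟨e0, e1, e2, e3, e4⟩ := marginalDist₃_lvl2Law
  rw [log_two_mul_shannonEntropy_fin5, e0, e1, e2, e3, e4,
    negMulLog_div' (by norm_num) (by norm_num), negMulLog_div' (by norm_num) (by norm_num),
    negMulLog_div' (by norm_num) (by norm_num), negMulLog_div' (by norm_num) (by norm_num),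
    negMulLog_div' (by norm_num) (by norm_num)]
  ring

/-- Integer certificate: `∏ u_x^{u_x} ≤ ∏ u_y^{u_y}` (`H_y ≤ H_x`). [folklore] -/
theorem cert_marginals :
    (1088 : ℕ) ^ 1088 * 882 ^ 882 * 474 ^ 474 * 4 ^ 4 ≤
      132 ^ 132 * 836 ^ 836 * 1305 ^ 1305 * 171 ^ 171 * 4 ^ 4 := by
  decide

/-! ## The certificates and the conclusion -/

/-- Integer certificate: `6^12834 ≤ 12^2010 · 38^4950` (`A³ ≤ B` for the per-position formats).
[folklore] -/
theorem cert_format : (6 : ℕ) ^ 12834 ≤ 12 ^ 2010 * 38 ^ 4950 := by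
  decide

/-- Integer certificate of the final inequality `19 (ln 64 − H_y ln 2 − ln W) ≤ 80 ln A`:
`2^46468 · 5^24795 · 11^18392 · 19^11213 · 29^24795 ≤ 3^91948 · 17^46512`. [folklore] -/
theorem cert_final :
    (2 : ℕ) ^ 46468 * 5 ^ 24795 * 11 ^ 18392 * 19 ^ 11213 * 29 ^ 24795 ≤ 3 ^ 91948 * 17 ^ 46512 := by
  decide

/-- **Level 2 of the saturation ladder at `ω(1,3,1)` (first instance of the hypothesis of the node
`TailDescentTwo`): `ω(1,3,1) ≤ 80/19`** (Le Gall 2012 §6 at `q = 6` in the tree's format currency,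
with the `3 : 3 : 2` family block at `σ = 19/20` and the explicit design `lvl2Word`).
[cite: LeGall2012, §6.1, Prop. 6.2 and Table 2] [cite: CoppersmithWinograd1990, §8]
[cite: Coppersmith1997, §3] -/
theorem omegaRect_one_three_one_le_80_19 : omegaRect ℂ 1 3 1 ≤ 80 / 19 := by
  -- the minimum marginal entropy is `H_y` (folded in: `H_y ≤ H_x`, `H_z = H_y`)
  have entropy₂_le_entropy₁ :
      shannonEntropy (marginalDist₂ lvl2Law) ≤ shannonEntropy (marginalDist₁ lvl2Law) := by
    have hlog : 0 < Real.log 2 := Real.log_pos one_lt_two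
    have h : ((1088 : ℕ) ^ 1088 * 882 ^ 882 * 474 ^ 474 * 4 ^ 4 : ℝ) ≤
        (132 : ℕ) ^ 132 * 836 ^ 836 * 1305 ^ 1305 * 171 ^ 171 * 4 ^ 4 := by
      exact_mod_cast cert_marginals
    push_cast at h
    have h' := Real.log_le_log (by positivity) h
    rw [Real.log_mul (by positivity) (by positivity), Real.log_mul (by positivity) (by positivity),
      Real.log_mul (by positivity) (by positivity), Real.log_mul (by positivity) (by positivity),
      Real.log_mul (by positivity) (by positivity), Real.log_mul (by positivity) (by positivity),
      Real.log_mul (by positivity) (by positivity)] at h'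
    simp only [Real.log_pow, Nat.cast_ofNat] at h'
    have e1 := entropy₁_lvl2Law
    have e2 := entropy₂_lvl2Law
    have key : Real.log 2 * shannonEntropy (marginalDist₂ lvl2Law) ≤
        Real.log 2 * shannonEntropy (marginalDist₁ lvl2Law) := by
      rw [e1, e2]
      linarith [h']
    exact le_of_mul_le_mul_left key hlog
  have entropy₃_eq_entropy₂ :
      shannonEntropy (marginalDist₃ lvl2Law) = shannonEntropy (marginalDist₂ lvl2Law) := by
    have hlog : Real.log 2 ≠ 0 := (Real.log_pos one_lt_two).ne'
    have e := entropy₃_lvl2Law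
    rw [← entropy₂_lvl2Law] at e
    exact mul_left_cancel₀ hlog e
  have min_entropy_lvl2Law :
      min (shannonEntropy (marginalDist₁ lvl2Law)) (min (shannonEntropy (marginalDist₂ lvl2Law))
        (shannonEntropy (marginalDist₃ lvl2Law))) = shannonEntropy (marginalDist₂ lvl2Law) := by
    rw [entropy₃_eq_entropy₂, min_self]
    exact min_eq_right entropy₂_le_entropy₁
  -- per-position value and formats: the `2448`-th roots of the totals
  set W : ℝ := Vtot ^ (((2448 : ℕ) : ℝ)⁻¹) with hWdef
  set A : ℝ := Xtot ^ (((2448 : ℕ) : ℝ)⁻¹) with hAdef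
  set B : ℝ := Ytot ^ (((2448 : ℕ) : ℝ)⁻¹) with hBdef
  have hW0 : 0 < W := Real.rpow_pos_of_pos Vtot_pos _
  have hA0 : 0 < A := Real.rpow_pos_of_pos Xtot_pos _
  have hB0 : 0 < B := Real.rpow_pos_of_pos Ytot_pos _
  have hWd : W ^ 2448 = Vtot := Real.rpow_inv_natCast_pow Vtot_pos.le (by norm_num)
  have hAd : A ^ 2448 = Xtot := Real.rpow_inv_natCast_pow Xtot_pos.le (by norm_num)
  have hBd : B ^ 2448 = Ytot := Real.rpow_inv_natCast_pow Ytot_pos.le (by norm_num)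
  have hblk : HasFormatValue (blockOf lvl2Word) (W ^ 2448) (A ^ 2448) (B ^ 2448) (A ^ 2448) := by
    rw [hWd, hAd, hBd]; exact hasFormatValue_lvl2Word
  -- the laser method on the valued word
  have hT := laserMethod_hasFormatValue_of_wordValue (bigCwSq ℂ 6) cwLev2 cwLev2 cwLev2
    cwSupport₂ (bigCwSq_cwSupport₂ ℂ 6) cwTight₂ cwTight₂ cwTight₂γ cwTight₂_injective
    cwTight₂_injective cwTight₂γ_injective cwTight₂_bound cwTight₂_bound cwTight₂_sum
    (by norm_num : 0 < 2448) lvl2Word lvl2Word_mem lvl2Law lvl2Law_eq hW0 hA0.le hB0.le hA0.le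
    hblk
  rw [maxEntropyPenalty_lvl2Law, sub_zero, min_entropy_lvl2Law] at hT
  -- logarithms of the roots
  have hlogW : Real.log W = (2448 : ℝ)⁻¹ * (138 * (6 * Real.log 2)) := by
    rw [hWdef, Real.log_rpow Vtot_pos, Vtot, one_mul, Real.log_pow,
      Real.log_rpow (by norm_num : (0 : ℝ) < 2)]
    push_cast; ring
  have hlogA : Real.log A = (2448 : ℝ)⁻¹ *
      (29 * Real.log 12 + 99 * Real.log 38 + 138 * (5 * Real.log 6)) := by
    rw [hAdef, Real.log_rpow Xtot_pos, Xtot, Real.log_mul (by positivity) (by positivity),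
      Real.log_mul (by positivity) (by positivity), Real.log_pow, Real.log_pow, Real.log_pow,
      Real.log_rpow (by norm_num : (0 : ℝ) < 6)]
    push_cast; ring
  have hlogB : Real.log B = (2448 : ℝ)⁻¹ *
      (288 * Real.log 12 + 792 * Real.log 38 + 138 * (57 / 10 * Real.log 6)) := by
    rw [hBdef, Real.log_rpow Ytot_pos, Ytot, Real.log_mul (by positivity) (by positivity),
      Real.log_mul (by positivity) (by positivity), Real.log_pow, Real.log_pow, Real.log_pow,
      Real.log_rpow (by norm_num : (0 : ℝ) < 6)]
    push_cast; ring
  have l12 : Real.log 12 = 2 * Real.log 2 + Real.log 3 := by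
    rw [show (12 : ℝ) = 2 ^ 2 * 3 by norm_num, Real.log_mul (by norm_num) (by norm_num),
      Real.log_pow]; push_cast; ring
  have l38 : Real.log 38 = Real.log 2 + Real.log 19 := by
    rw [show (38 : ℝ) = 2 * 19 by norm_num, Real.log_mul (by norm_num) (by norm_num)]
  have l6 : Real.log 6 = Real.log 2 + Real.log 3 := by
    rw [show (6 : ℝ) = 2 * 3 by norm_num, Real.log_mul (by norm_num) (by norm_num)]
  have l64 : Real.log 64 = 6 * Real.log 2 := by
    rw [show (64 : ℝ) = 2 ^ 6 by norm_num, Real.log_pow]; push_cast; ring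
  have l2448 : Real.log 2448 = 4 * Real.log 2 + 2 * Real.log 3 + Real.log 17 := by
    rw [show (2448 : ℝ) = 2 ^ 4 * 3 ^ 2 * 17 by norm_num, Real.log_mul (by norm_num) (by norm_num),
      Real.log_mul (by norm_num) (by norm_num), Real.log_pow, Real.log_pow]; push_cast; ring
  have l132 : Real.log 132 = 2 * Real.log 2 + Real.log 3 + Real.log 11 := by
    rw [show (132 : ℝ) = 2 ^ 2 * 3 * 11 by norm_num, Real.log_mul (by norm_num) (by norm_num),
      Real.log_mul (by norm_num) (by norm_num), Real.log_pow]; push_cast; ring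
  have l836 : Real.log 836 = 2 * Real.log 2 + Real.log 11 + Real.log 19 := by
    rw [show (836 : ℝ) = 2 ^ 2 * 11 * 19 by norm_num, Real.log_mul (by norm_num) (by norm_num),
      Real.log_mul (by norm_num) (by norm_num), Real.log_pow]; push_cast; ring
  have l1305 : Real.log 1305 = 2 * Real.log 3 + Real.log 5 + Real.log 29 := by
    rw [show (1305 : ℝ) = 3 ^ 2 * 5 * 29 by norm_num, Real.log_mul (by norm_num) (by norm_num),
      Real.log_mul (by norm_num) (by norm_num), Real.log_pow]; push_cast; ring
  have l171 : Real.log 171 = 2 * Real.log 3 + Real.log 19 := by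
    rw [show (171 : ℝ) = 3 ^ 2 * 19 by norm_num, Real.log_mul (by norm_num) (by norm_num),
      Real.log_pow]; push_cast; ring
  have l4 : Real.log 4 = 2 * Real.log 2 := by
    rw [show (4 : ℝ) = 2 ^ 2 by norm_num, Real.log_pow]; push_cast; ring
  -- (1) `A > 1`
  have hX1 : 1 < Xtot := by
    unfold Xtot
    have h1 : (1 : ℝ) < 12 ^ 29 * 38 ^ 99 := by norm_num
    have h2 : (1 : ℝ) ≤ ((6 : ℝ) ^ (5 : ℝ)) ^ 138 :=
      one_le_pow₀ (Real.one_le_rpow (by norm_num) (by norm_num))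
    exact one_lt_mul_of_lt_of_le h1 h2
  have hA1 : 1 < A := Real.one_lt_rpow hX1 (by positivity)
  have hlA : 0 < Real.log A := Real.log_pos hA1
  -- (2) the format inequality `A³ ≤ B`
  have hAB : A ^ (3 : ℝ) ≤ B := by
    rw [← Real.log_le_log_iff (Real.rpow_pos_of_pos hA0 _) hB0, Real.log_rpow hA0, hlogA, hlogB]
    have hc : ((6 : ℕ) ^ 12834 : ℝ) ≤ (12 : ℕ) ^ 2010 * (38 : ℕ) ^ 4950 := by
      exact_mod_cast cert_format
    push_cast at hc
    have hc' := Real.log_le_log (by positivity) hc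
    rw [Real.log_mul (by positivity) (by positivity)] at hc'
    simp only [Real.log_pow, Nat.cast_ofNat] at hc'
    linarith
  -- (3) the packing bound `2^{H_y} W A^{ω(1,3,1)} ≤ R̃(CW_6^{⊗2}) ≤ 64`, in logarithms
  have hmain := mul_rpow_omegaRect_le_asymptoticRank_of_hasFormatValue hT hA1 (by norm_num) hAB
  have h64 := hmain.trans asymptoticRank_bigCwSq_six_le
  have hpos : 0 < (2 : ℝ) ^ shannonEntropy (marginalDist₂ lvl2Law) * W * A ^ omegaRect ℂ 1 3 1 := by
    positivity
  have hlog := Real.log_le_log hpos h64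
  rw [Real.log_mul (by positivity) (by positivity), Real.log_mul (by positivity) (by positivity),
    Real.log_rpow (by norm_num : (0 : ℝ) < 2), Real.log_rpow hA0] at hlog
  -- (4) the final certificate: `ln 64 − H_y ln 2 − ln W ≤ (80/19) ln A`
  have e2 := entropy₂_lvl2Law
  rw [l2448, l132, l836, l1305, l171, l4] at e2
  have hc : ((2 : ℕ) ^ 46468 * (5 : ℕ) ^ 24795 * (11 : ℕ) ^ 18392 * (19 : ℕ) ^ 11213 *
      (29 : ℕ) ^ 24795 : ℝ) ≤ (3 : ℕ) ^ 91948 * (17 : ℕ) ^ 46512 := by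
    exact_mod_cast cert_final
  push_cast at hc
  have hc' := Real.log_le_log (by positivity) hc
  rw [Real.log_mul (by positivity) (by positivity), Real.log_mul (by positivity) (by positivity),
    Real.log_mul (by positivity) (by positivity), Real.log_mul (by positivity) (by positivity),
    Real.log_mul (by positivity) (by positivity)] at hc'
  simp only [Real.log_pow, Nat.cast_ofNat] at hc'
  have hfin : Real.log 64 - shannonEntropy (marginalDist₂ lvl2Law) * Real.log 2 - Real.log W ≤
      80 / 19 * Real.log A := by
    rw [hlogW, hlogA, l64, l12, l38, l6]
    linarith
  have key : omegaRect ℂ 1 3 1 * Real.log A ≤ 80 / 19 * Real.log A := by linarith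
  exact le_of_mul_le_mul_right key hlA

/-- **`ω(1,3,1) < 4.2106`.** [cite: LeGall2012, Table 2] -/
theorem omegaRect_one_three_one_lt_4_2106 : omegaRect ℂ 1 3 1 < 4.2106 :=
  lt_of_le_of_lt omegaRect_one_three_one_le_80_19 (by norm_num)

/-- **Level 2 beats the tree's level-1 price at `ω(1,3,1)`**: `80/19 < 13/3` (the unconditional
five-pattern bound `OctaveBudgetKernelFamily.farEdge_three`, `ω(1,3,1) ≤ 13/3`), and beats descent
from the `k = 2` rung (`101/31 + 1 = 4.258…`). [cite: LeGall2012, Table 2] -/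
theorem omegaRect_one_three_one_lt_farEdge : omegaRect ℂ 1 3 1 < 13 / 3 :=
  lt_of_le_of_lt omegaRect_one_three_one_le_80_19 (by norm_num)

/-- The remaining gap of the rung to `ω(1,3,1) = 4` (the `k = 3` instance of the hypothesis of
`TailDescentTwo`) is `< 0.2106`: the defect `ω(1,k,1) − (k+1)` priced at level 2 DECREASES from
`k = 2` (`0.2581`) to `k = 3` (`0.2106`). [cite: LeGall2012, Table 2] -/
theorem omegaRect_one_three_one_sub_four_lt : omegaRect ℂ 1 3 1 - 4 < 0.2106 := by
  have := omegaRect_one_three_one_le_80_19; norm_num at this ⊢; linarith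

/-- **Descent to the tail**: `ω(1,k,1) ≤ k + 23/19` for every real `k ≥ 3`
(`omegaRect_one_mid_one_le_add`). [cite: Coppersmith1997, §3] -/
theorem omegaRect_one_mid_one_le_add_of_three (k : ℝ) (hk : 3 ≤ k) :
    omegaRect ℂ 1 k 1 ≤ k + 23 / 19 := by
  have h := omegaRect_one_mid_one_le_add (K := ℂ) hk
  have h3 := omegaRect_one_three_one_le_80_19
  norm_num at h h3 ⊢
  linarith

end Summit.MatrixMultiplication.MatrixMultiplication.Theorems.SaturationLadderLevelTwoK3

end
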